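/-
Copyright: the b2b-balaban T⁴-continuum CRUX team, row NE7b OWNER lineage `t4-ne7b-p1` (gen 138). Project licence.
-/
import Summits.QuantumFields.BalabanUV.T4Continuum.Spine.NE7b.SupBlockDressedStep

/-!
# TILTED AVERAGING PRESERVES KERNEL LETTERS — the first half of SCOPING (d10)(1): in the covariance formula (403)
# `HessW(ψ)[e_x,e_y] = ⟨U″(ω+ψ)[e_x,e_y]⟩_ν − Cov_ν(U′[e_x], U′[e_y])` the AVERAGE term inherits the INPUT's ROW-SUM (kernel) letter
# `Σ_y |U″(φ)[e_x,e_y]| ≤ κr` UNIFORMLY in the background `ψ`: `Σ_y |Z(ψ)⁻¹∫e^{−U(ω+ψ)}U″(ω+ψ)[e_x,e_y] dN(0,Γ)| ≤ κr` — because a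
# normalised nonnegative weight is a convex average and row sums are convex.  The abstract lemma is stated for ANY measure, weight and
# kernel-valued integrand; the road's block objects ((399)∕(410): `Z > 0`, integrability under the regulator) are then plugged in BY NAME
# (row NE7b, node U5c; [folklore])

Cell `pub-balaban`, sub-cell `t4`, spine estimate NE7b (`T4WeightBudget.RelWeightBound`; the cell's OWN estimate — NOT PRINTED in
[Bałaban 1983–89], NOT PROVED).  Crux-route work under `Spine/NE7b/` by the row OWNER (`t4-ne7b-p1` gen 138, file (437)) under FREEZE
(0)'s crux-prover clause; NOTHING of Bałaban's is named as a Lean object, valued or asserted; no `T4Continuum/Support` leaf typed; no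
`def`, no notation; zero `sorry`.  Imports (BY NAME): (410) `…SupBlockDressedStep` (`block_Z_pos`), through it (399)
`…SupBlockEffectiveActionDerivative` (`integrable_exp_neg_block`) and `…SupEffectiveActionDerivative` (`mul_opBound_le_of_le`).

WHY (memo `records/SCOPING-d10-letter-format.md`, DECISION (d10)(1)).  (433) fixed the letter format that iterates: ROW-SUM letters of
the kernels of the potential's derivatives.  To re-run the fluctuation step (427) in that format one needs the row sums of the OUTPUT's
Hessian kernel `HessW(ψ)_{xy}`; by (403) it is a tilted average of the input's Hessian kernel minus a tilted covariance of the input's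
gradient components.  THIS FILE settles the average: it never increases row sums (§1, a two-line convexity fact, typed with the
integrability bookkeeping), and instantiates it on the block objects (§2).  The COVARIANCE term is the located hard half ((d10)(2):
Brascamp–Lieb ∕ Helffer–Sjöstrand in kernel form with the decay of `(M − λ)⁻¹` — NOT here).

WHAT IS PROVED ([folklore]):
* §1 **`rowsum_of_weighted_average`** (any measure `μ`, weight `wgt ≥ 0` with `0 < ∫wgt`, kernels `F ω x y` with `Σ_y |F ω x y| ≤ K` for
  every `ω, x`, and `wgt·F_{xy}` integrable ⟹ `Σ_y |(∫wgt)⁻¹·∫ wgt·F_{xy}| ≤ K` for every `x`).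
* §2 **`tilted_hessian_average_rowsum`** (the block class (399)–(403) plus the input row-sum letter
  `hU''row : Σ_y |U″(φ)[e_x,e_y]| ≤ κr` ⟹ `Σ_y |Z(ψ)⁻¹·∫e^{−U(ω+ψ)}·U″(ω+ψ)[e_x,e_y] dN(0,Γ)| ≤ κr` for every `ψ, x`;
  `e_x = EuclideanSpace.single x 1`), with `integrable_weighted_hessian_entry` (the integrand's integrability under the regulator).
* §3 toy (kernel): a constant kernel with zero rows averages to zero rows.

HONEST (what this is NOT).  Only the average term of (403)'s covariance formula; the covariance term's kernel letter (decay of correlations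
of the tilted law), the higher kernels (`T(ψ)_{xyz}` of (419)∕(425)), and the full kernel-format re-run of (427) are NOT here ((d10)(2)–(3)).
Scalar skeleton ((A3), NC-NE7b-α UNRULED); nothing of Bałaban's asserted.  BY-NAME EFFECT ON THE WALL: NONE.  NE7b NOT PRINTED ∕ NOT
PROVED; spine PROVED 0∕9; rung (B)+1 — the programme's measures remain FINITE-torus statements; NOT the mass gap, NOT Clay.  HONEST
DEPENDENCY: continuum YM on T⁴ ⇐ BetaPertH ∧ nine spine estimates (0∕9 proved); BetaPertH ⇐ (D1) ∧ (D4) ∧ CAP+tail; G-an2-4 gates asym,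
D1 and NE2∕3∕4.
-/

set_option autoImplicit false
set_option maxSynthPendingDepth 2

noncomputable section

namespace Summit.QuantumFields.BalabanUV.T4Continuum.NE7b.SupBlockHessianKernelAverage

open MeasureTheory ProbabilityTheory Finset Real
open scoped BigOperators Matrix
open SupBlockDressedStep (block_Z_pos)
open SupBlockEffectiveActionDerivative (integrable_exp_neg_block)
open SupEffectiveActionDerivative (mul_opBound_le_of_le)

/-! ## §1. Averaging preserves row-sum letters -/

/-- **A NORMALISED NONNEGATIVE WEIGHT NEVER INCREASES ROW SUMS**: for a measure `μ`, a weight `wgt ≥ 0` with `0 < ∫wgt dμ`, and kernels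
`F ω` with `Σ_y |F ω x y| ≤ K` for all `ω, x` (each `wgt·F_{xy}` integrable), the averaged kernel `(∫wgt)⁻¹∫wgt·F_{xy}` has
`Σ_y |·| ≤ K` for every `x`. [folklore] -/
theorem rowsum_of_weighted_average {Ω : Type*} [MeasurableSpace Ω] (μ : Measure Ω) {κ : Type*} [Fintype κ] (wgt : Ω → ℝ)
    (F : Ω → κ → κ → ℝ) {K : ℝ} (hwgt : ∀ ω, 0 ≤ wgt ω) (hwint : Integrable wgt μ) (hZ : 0 < ∫ ω, wgt ω ∂μ)
    (hint : ∀ x y, Integrable (fun ω => wgt ω * F ω x y) μ) (hrow : ∀ ω x, ∑ y, |F ω x y| ≤ K) :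
    ∀ x, ∑ y, |(∫ ω, wgt ω ∂μ)⁻¹ * ∫ ω, wgt ω * F ω x y ∂μ| ≤ K := by
  intro x
  have hZinv : 0 ≤ (∫ ω, wgt ω ∂μ)⁻¹ := inv_nonneg.2 hZ.le
  -- each `wgt·|F_{xy}|` is integrable, being the absolute value of an integrable function
  have habs : ∀ y, Integrable (fun ω => wgt ω * |F ω x y|) μ := by
    intro y
    have h := (hint x y).abs
    refine h.congr (ae_of_all _ fun ω => ?_)
    simp only [abs_mul, abs_of_nonneg (hwgt ω)]
  have h1 : ∀ y, |(∫ ω, wgt ω ∂μ)⁻¹ * ∫ ω, wgt ω * F ω x y ∂μ| ≤ (∫ ω, wgt ω ∂μ)⁻¹ * ∫ ω, wgt ω * |F ω x y| ∂μ := by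
    intro y
    rw [abs_mul, abs_of_nonneg hZinv]
    refine mul_le_mul_of_nonneg_left ?_ hZinv
    refine abs_integral_le_integral_abs.trans (le_of_eq (integral_congr_ae (ae_of_all _ fun ω => ?_)))
    simp only [abs_mul, abs_of_nonneg (hwgt ω)]
  have h2 : ∑ y, (∫ ω, wgt ω ∂μ)⁻¹ * ∫ ω, wgt ω * |F ω x y| ∂μ = (∫ ω, wgt ω ∂μ)⁻¹ * ∫ ω, wgt ω * ∑ y, |F ω x y| ∂μ := by
    rw [← Finset.mul_sum, ← integral_finsetSum Finset.univ fun y _ => habs y]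
    congr 1
    refine integral_congr_ae (ae_of_all _ fun ω => ?_)
    simp only [Finset.mul_sum]
  have h3 : ∫ ω, wgt ω * ∑ y, |F ω x y| ∂μ ≤ ∫ ω, wgt ω * K ∂μ := by
    refine integral_mono ?_ (hwint.mul_const K) fun ω => mul_le_mul_of_nonneg_left (hrow ω x) (hwgt ω)
    have h := integrable_finsetSum Finset.univ fun y (_ : y ∈ Finset.univ) => habs y
    refine h.congr (ae_of_all _ fun ω => ?_)
    simp only [Finset.mul_sum]
  calc ∑ y, |(∫ ω, wgt ω ∂μ)⁻¹ * ∫ ω, wgt ω * F ω x y ∂μ| ≤ ∑ y, (∫ ω, wgt ω ∂μ)⁻¹ * ∫ ω, wgt ω * |F ω x y| ∂μ :=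
        Finset.sum_le_sum fun y _ => h1 y
    _ = (∫ ω, wgt ω ∂μ)⁻¹ * ∫ ω, wgt ω * ∑ y, |F ω x y| ∂μ := h2
    _ ≤ (∫ ω, wgt ω ∂μ)⁻¹ * ∫ ω, wgt ω * K ∂μ := mul_le_mul_of_nonneg_left h3 hZinv
    _ = K := by rw [integral_mul_const, ← mul_assoc, inv_mul_cancel₀ hZ.ne', one_mul]

/-! ## §2. The road's tilted average of the input Hessian kernel -/

variable {ι : Type} [Fintype ι] [DecidableEq ι]

variable {Γ : Matrix ι ι ℝ} {γop : ℝ} {U : EuclideanSpace ℝ ι → ℝ} {U' : EuclideanSpace ℝ ι → EuclideanSpace ℝ ι →L[ℝ] ℝ}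
  {U'' : EuclideanSpace ℝ ι → EuclideanSpace ℝ ι →L[ℝ] EuclideanSpace ℝ ι →L[ℝ] ℝ} {κ₀ κ₂ κr τ δ θ : ℝ}

/-- **The weighted Hessian entry is integrable** under the regulator: `ω ↦ e^{−U(ω+ψ)}·U″(ω+ψ)[e_x,e_y]` is dominated by `κ₂·e^{−U(ω+ψ)}`. [folklore] -/
theorem integrable_weighted_hessian_entry (hΓ : Γ.PosSemidef) (hΓop : (γop • (1 : Matrix ι ι ℝ) - Γ).PosSemidef) (Y : Finset ι)
    (hUd : ∀ φ : EuclideanSpace ℝ ι, HasFDerivAt U (U' φ) φ) (hU''c : Continuous U'') (hκ₀ : 0 ≤ κ₀) (hτ : 0 < τ) (hδ : 0 < δ)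
    (hθ0 : 0 < θ) (hθ1 : θ < 1) (hκθ : (2 * κ₀ * (1 + τ) + 4 * δ) * γop ≤ θ)
    (hstab : ∀ φ : EuclideanSpace ℝ ι, -(κ₀ * ∑ x ∈ Y, φ x ^ 2) ≤ U φ) (hU''b : ∀ φ : EuclideanSpace ℝ ι, ‖U'' φ‖ ≤ κ₂)
    (ψ : EuclideanSpace ℝ ι) (x y : ι) :
    Integrable (fun ω : EuclideanSpace ℝ ι => exp (-U (ω + ψ)) * U'' (ω + ψ) (EuclideanSpace.single x (1 : ℝ)) (EuclideanSpace.single y (1 : ℝ)))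
      (multivariateGaussian 0 Γ) := by
  have hUc : Continuous U := continuous_iff_continuousAt.2 fun φ => (hUd φ).continuousAt
  have hκθ₀ : 2 * κ₀ * (1 + τ) * γop ≤ θ := mul_opBound_le_of_le (by positivity) (by linarith) hθ0.le hκθ
  have hI := integrable_exp_neg_block hΓ hΓop Y hUc.measurable hκ₀ hτ hθ1 hκθ₀ hstab ψ
  have hmeas : AEStronglyMeasurable (fun ω : EuclideanSpace ℝ ι => exp (-U (ω + ψ)) *
      U'' (ω + ψ) (EuclideanSpace.single x (1 : ℝ)) (EuclideanSpace.single y (1 : ℝ))) (multivariateGaussian 0 Γ) := by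
    refine Continuous.aestronglyMeasurable ?_
    refine (continuous_exp.comp (hUc.comp (continuous_id.add continuous_const)).neg).mul ?_
    exact ((hU''c.comp (continuous_id.add continuous_const)).clm_apply continuous_const).clm_apply continuous_const
  refine (hI.const_mul κ₂).mono' hmeas (ae_of_all _ fun ω => ?_)
  rw [Real.norm_eq_abs, abs_mul, abs_of_pos (exp_pos _), mul_comm κ₂]
  refine mul_le_mul_of_nonneg_left ?_ (exp_pos _).le
  calc |U'' (ω + ψ) (EuclideanSpace.single x (1 : ℝ)) (EuclideanSpace.single y (1 : ℝ))|
      = ‖U'' (ω + ψ) (EuclideanSpace.single x (1 : ℝ)) (EuclideanSpace.single y (1 : ℝ))‖ := (Real.norm_eq_abs _).symm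
    _ ≤ ‖U'' (ω + ψ) (EuclideanSpace.single x (1 : ℝ))‖ * ‖EuclideanSpace.single y (1 : ℝ)‖ := ContinuousLinearMap.le_opNorm _ _
    _ ≤ ‖U'' (ω + ψ)‖ * ‖EuclideanSpace.single x (1 : ℝ)‖ * ‖EuclideanSpace.single y (1 : ℝ)‖ := by
        gcongr; exact ContinuousLinearMap.le_opNorm _ _
    _ ≤ κ₂ := by
        have hs : ∀ z : ι, ‖EuclideanSpace.single z (1 : ℝ)‖ = 1 := fun z => by simp
        rw [hs x, hs y, mul_one, mul_one]
        exact hU''b _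

/-- **THE TILTED AVERAGE OF THE INPUT HESSIAN KERNEL KEEPS THE INPUT'S ROW-SUM LETTER, UNIFORMLY IN THE BACKGROUND**: for the block class
((399)–(403) hypotheses) with the kernel letter `Σ_y |U″(φ)[e_x,e_y]| ≤ κr` at every `φ, x`:
`Σ_y |Z(ψ)⁻¹·∫e^{−U(ω+ψ)}·U″(ω+ψ)[e_x,e_y] dN(0,Γ)| ≤ κr` for every `ψ` and `x`. [folklore] -/
theorem tilted_hessian_average_rowsum (hΓ : Γ.PosSemidef) (hΓop : (γop • (1 : Matrix ι ι ℝ) - Γ).PosSemidef) (Y : Finset ι)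
    (hUd : ∀ φ : EuclideanSpace ℝ ι, HasFDerivAt U (U' φ) φ) (hU''c : Continuous U'') (hκ₀ : 0 ≤ κ₀) (hτ : 0 < τ) (hδ : 0 < δ)
    (hθ0 : 0 < θ) (hθ1 : θ < 1) (hκθ : (2 * κ₀ * (1 + τ) + 4 * δ) * γop ≤ θ)
    (hstab : ∀ φ : EuclideanSpace ℝ ι, -(κ₀ * ∑ x ∈ Y, φ x ^ 2) ≤ U φ) (hU''b : ∀ φ : EuclideanSpace ℝ ι, ‖U'' φ‖ ≤ κ₂)
    (hU''row : ∀ (φ : EuclideanSpace ℝ ι) (x : ι), ∑ y, |U'' φ (EuclideanSpace.single x (1 : ℝ)) (EuclideanSpace.single y (1 : ℝ))| ≤ κr)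
    (ψ : EuclideanSpace ℝ ι) :
    ∀ x : ι, ∑ y, |(∫ ω : EuclideanSpace ℝ ι, exp (-U (ω + ψ)) ∂(multivariateGaussian 0 Γ))⁻¹ *
        ∫ ω : EuclideanSpace ℝ ι, exp (-U (ω + ψ)) * U'' (ω + ψ) (EuclideanSpace.single x (1 : ℝ)) (EuclideanSpace.single y (1 : ℝ))
          ∂(multivariateGaussian 0 Γ)| ≤ κr := by
  have hUc : Continuous U := continuous_iff_continuousAt.2 fun φ => (hUd φ).continuousAt
  have hκθ₀ : 2 * κ₀ * (1 + τ) * γop ≤ θ := mul_opBound_le_of_le (by positivity) (by linarith) hθ0.le hκθ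
  have hI := integrable_exp_neg_block hΓ hΓop Y hUc.measurable hκ₀ hτ hθ1 hκθ₀ hstab ψ
  have hZ := block_Z_pos hΓ hΓop Y hUd hκ₀ hτ hδ hθ0 hθ1 hκθ hstab ψ
  exact rowsum_of_weighted_average (multivariateGaussian 0 Γ) (fun ω : EuclideanSpace ℝ ι => exp (-U (ω + ψ)))
    (fun (ω : EuclideanSpace ℝ ι) (x y : ι) => U'' (ω + ψ) (EuclideanSpace.single x (1 : ℝ)) (EuclideanSpace.single y (1 : ℝ)))
    (fun ω => (exp_pos _).le) hI hZ
    (fun x y => integrable_weighted_hessian_entry hΓ hΓop Y hUd hU''c hκ₀ hτ hδ hθ0 hθ1 hκθ hstab hU''b ψ x y)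
    (fun ω x => hU''row (ω + ψ) x)

/-! ## §3. Toy -/

/-- Toy (kernel): the zero kernel has zero row sums, and so does any weighted average of it. -/
example {Ω : Type*} [MeasurableSpace Ω] (μ : Measure Ω) (wgt : Ω → ℝ) (hwgt : ∀ ω, 0 ≤ wgt ω) (hwint : Integrable wgt μ)
    (hZ : 0 < ∫ ω, wgt ω ∂μ) (x : Fin 2) :
    ∑ y : Fin 2, |(∫ ω, wgt ω ∂μ)⁻¹ * ∫ ω, wgt ω * (fun (_ : Ω) (_ _ : Fin 2) => (0 : ℝ)) ω x y ∂μ| ≤ 0 :=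
  rowsum_of_weighted_average μ wgt (fun _ _ _ => 0) hwgt hwint hZ (fun _ _ => by simp) (fun _ _ => by simp) x

end Summit.QuantumFields.BalabanUV.T4Continuum.NE7b.SupBlockHessianKernelAverage

end
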